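import Summits.CriticalPhenomena.PercolationContinuityZ3.Theorems.PercNearOneGluingNoHeavyPcintBSMRFast3
import Summits.CriticalPhenomena.PercolationContinuityZ3.Theorems.PercNearOneGluingNoHeavyPcintBSMXSiteKernel
import HarnessLib

/-!
# PCINT lane, PHASE 9 (reach-`m` pieces), SITE version: a bit-mask site certificate functional in the plane

Cell `prim-pcint`, seat `prim-pcint-1` (gen 17); memo `run/shared/lean/prim/pcint/T-FIBRE-ROUTE.md` §PHASE 9.
The site analogue of …PcintBSMRFast3: block vertices (start vertex and entered vertices, `BSMX.SV2`) are coded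
by `(x+12)·25 + (y+12)` (`BSMR.vcode2`, bit lists `BSMR.tvbits`), the shared-vertex count is the bit-mask count
`BSMR.Smask` on these lists (**`BSMR.SV2_eq_Smask`**), and the site functional **`BSMR.certFastMS`** (no time-edge
term; both time-axis branches carry `x^{SV}`) bridges to `BSMX.certLHSVz` (**`BSMR.certLHSVz_eq_certFastMS`**).
-/

noncomputable section

namespace Summit.CriticalPhenomena.PercolationContinuityZ3.Theorems.Pcint.BSMR

open Finset OSM BSM BSMX Literature.Probability.Percolation Literature.Probability.LatticeModels

variable {np k : ℕ}

/-! ### Vertex codes and bit lists -/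

/-- The compact code of a plane vertex with coordinates `≥ -12`: `(x+12)·25 + (y+12)`. -/
def vcode2 (v : ℤ × ℤ) : ℕ := ((v.1 + 12) * 25 + (v.2 + 12)).toNat

/-- The code of a pair vertex key (the time component, always `0` here, is ignored). -/
def vcodeK {k : ℕ} (q : VKey2 k) : ℕ := vcode2 q.2

/-- The codes of the entered vertices of a piece started at `u` (mirror of `BSMX.tverts2`). -/
def tvb : ℤ × ℤ → List (Fin 2 × Bool) → List ℕ
  | _, [] => []
  | u, q :: σ => vcode2 (u + sv2 q) :: tvb (u + sv2 q) σ

/-- The vertex bit list of a piece started at `u`: the start vertex and the entered vertices. -/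
def tvbits (u : ℤ × ℤ) (σ : List (Fin 2 × Bool)) : List ℕ := vcode2 u :: tvb u σ

/-- The codes of the entered vertices are the list `tvb`. -/
theorem image_vcodeK_tverts2 (k : ℕ) : ∀ (u : ℤ × ℤ) (σ : List (Fin 2 × Bool)),
    (tverts2 k u σ).image vcodeK = (tvb u σ).toFinset
  | u, [] => by simp [tverts2, tvb]
  | u, q :: σ => by
    rw [tverts2, tvb, Finset.image_insert, image_vcodeK_tverts2 k _ σ, List.toFinset_cons]
    rfl

/-- **The codes of the block vertices are the vertex bit list.** -/
theorem image_vcodeK_verts (k : ℕ) (u : ℤ × ℤ) (σ : List (Fin 2 × Bool)) :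
    (insert ((0 : Fin k → ℤ), u) (tverts2 k u σ)).image vcodeK = (tvbits u σ).toFinset := by
  rw [Finset.image_insert, image_vcodeK_tverts2, tvbits, List.toFinset_cons]
  rfl

/-- Entered vertices have time component `0` and coordinates within `|σ|` of the start. -/
theorem mem_tverts2 (k : ℕ) : ∀ (u : ℤ × ℤ) (σ : List (Fin 2 × Bool)) (q : VKey2 k), q ∈ tverts2 k u σ →
    q.1 = 0 ∧ |q.2.1 - u.1| ≤ σ.length ∧ |q.2.2 - u.2| ≤ σ.length
  | u, [], q, h => by simp [tverts2] at h
  | u, p :: σ, q, h => by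
    rw [tverts2, Finset.mem_insert] at h
    obtain ⟨hs1, hs2⟩ := abs_sv2_le p
    rw [abs_le] at hs1 hs2
    rcases h with rfl | h
    · refine ⟨rfl, ?_, ?_⟩
      · simp [abs_le]; constructor <;> linarith [hs1.1, hs1.2]
      · simp [abs_le]; constructor <;> linarith [hs2.1, hs2.2]
    · obtain ⟨ha, hb1, hb2⟩ := mem_tverts2 k _ σ q h
      refine ⟨ha, ?_, ?_⟩
      · rw [abs_le] at hb1 ⊢
        simp only [Prod.fst_add, List.length_cons] at hb1 ⊢
        push_cast
        constructor <;> linarith [hb1.1, hb1.2, hs1.1, hs1.2]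
      · rw [abs_le] at hb2 ⊢
        simp only [Prod.snd_add, List.length_cons] at hb2 ⊢
        push_cast
        constructor <;> linarith [hb2.1, hb2.2, hs2.1, hs2.2]

/-- Block vertices (start at the origin) have time component `0` and coordinates within `|σ|`. -/
theorem mem_verts {k : ℕ} {σ : List (Fin 2 × Bool)} {q : VKey2 k}
    (h : q ∈ insert ((0 : Fin k → ℤ), ((0 : ℤ), (0 : ℤ))) (tverts2 k (0, 0) σ)) :
    q.1 = 0 ∧ |q.2.1| ≤ σ.length ∧ |q.2.2| ≤ σ.length := by
  rw [Finset.mem_insert] at h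
  rcases h with rfl | h
  · simp
  · obtain ⟨h1, h2, h3⟩ := mem_tverts2 k _ _ q h
    simp only [sub_zero] at h2 h3
    exact ⟨h1, h2, h3⟩

/-- The vertex code as an integer, for coordinates `≥ -12`. -/
theorem vcode2_cast {v : ℤ × ℤ} (h1 : -12 ≤ v.1) (h2 : -12 ≤ v.2) :
    ((vcode2 v : ℕ) : ℤ) = (v.1 + 12) * 25 + (v.2 + 12) := by
  unfold vcode2
  rw [Int.toNat_of_nonneg (by omega)]

/-- **Injectivity of the vertex code** on keys with time `0` and coordinates in `[-12, 12]`. -/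
theorem vcodeK_inj {q q' : VKey2 k} (ht : q.1 = 0) (ht' : q'.1 = 0)
    (h1 : |q.2.1| ≤ 12) (h2 : |q.2.2| ≤ 12) (h1' : |q'.2.1| ≤ 12) (h2' : |q'.2.2| ≤ 12)
    (h : vcodeK q = vcodeK q') : q = q' := by
  obtain ⟨s, x, y⟩ := q
  obtain ⟨s', x', y'⟩ := q'
  simp only at ht ht'
  subst ht; subst ht'
  replace h1 : -12 ≤ x ∧ x ≤ 12 := abs_le.1 h1
  replace h2 : -12 ≤ y ∧ y ≤ 12 := abs_le.1 h2
  replace h1' : -12 ≤ x' ∧ x' ≤ 12 := abs_le.1 h1'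
  replace h2' : -12 ≤ y' ∧ y' ≤ 12 := abs_le.1 h2'
  simp only [vcodeK] at h
  have hc : ((vcode2 (x, y) : ℕ) : ℤ) = vcode2 (x', y') := by exact_mod_cast h
  rw [vcode2_cast (v := (x, y)) h1.1 h2.1, vcode2_cast (v := (x', y')) h1'.1 h2'.1] at hc
  replace hc : (x + 12) * 25 + (y + 12) = (x' + 12) * 25 + (y' + 12) := hc
  have e1 : x = x' := by omega
  have e2 : y = y' := by omega
  subst e1; subst e2
  rfl

/-- The vertex-code offset of a shift by `y`: `y₁·25 + y₂`. -/
def voff (y : ℤ × ℤ) : ℤ := y.1 * 25 + y.2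

/-- Shifting a vertex key (coordinates `≥ -12` before and after) shifts its code. -/
theorem vcodeK_shift (y : ℤ × ℤ) {q : VKey2 k} (h1 : -12 ≤ q.2.1) (h2 : -12 ≤ q.2.2)
    (h1' : -12 ≤ q.2.1 + y.1) (h2' : -12 ≤ q.2.2 + y.2) :
    ((vcodeK (shiftV2 k y q) : ℕ) : ℤ) = vcodeK q + voff y := by
  obtain ⟨s, x₁, x₂⟩ := q
  simp only [vcodeK, shiftV2, Function.Embedding.coeFn_mk, voff]
  simp only at h1 h2 h1' h2'
  rw [vcode2_cast (by simpa using h1') (by simpa using h2'), vcode2_cast h1 h2]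
  simp only [Prod.fst_add, Prod.snd_add]
  ring

/-- The shift amount of the second vertex mask at offset `y`: `312 + voff y ≥ 0` for `|y| ≤ 12`. -/
def shOfV (y : ℤ × ℤ) : ℕ := (312 + voff y).toNat

/-- **`SV2 = Smask`** on the vertex bit lists (pieces of length `≤ 6`, `|y| ≤ 6`, first list duplicate-free). -/
theorem SV2_eq_Smask (pc : Fin np → List (Fin 2 × Bool)) (k : ℕ) (y : Fin 2 → ℤ) (σ σ' : Fin np)
    {bA bB : List ℕ} (hA : bA = tvbits (0, 0) (pc σ)) (hB : bB = tvbits (0, 0) (pc σ')) (hAn : bA.Nodup)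
    (hσ : (pc σ).length ≤ 6) (hσ' : (pc σ').length ≤ 6) (hy0 : |y 0| ≤ 6) (hy1 : |y 1| ≤ 6) :
    SV2 pc k y σ σ' = Smask (maskOf (bA.map (· + 312))) (bA.map (· + 312)) (Nat.shiftLeft (maskOf bB) (shOfV (tr2 y))) := by
  set TA := insert ((0 : Fin k → ℤ), ((0 : ℤ), (0 : ℤ))) (tverts2 k (0, 0) (pc σ)) with hTA
  set TB := insert ((0 : Fin k → ℤ), ((0 : ℤ), (0 : ℤ))) (tverts2 k (0, 0) (pc σ')) with hTB
  set sh := shiftV2 k (tr2 y) with hsh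
  set s : ℕ := shOfV (tr2 y) with hs
  have hy0' : |(tr2 y).1| ≤ 6 := hy0
  have hy1' : |(tr2 y).2| ≤ 6 := hy1
  rw [abs_le] at hy0' hy1'
  have hoff : 312 + voff (tr2 y) ≥ 0 := by unfold voff; omega
  have hs' : (s : ℤ) = 312 + voff (tr2 y) := by rw [hs, shOfV, Int.toNat_of_nonneg hoff]
  have smA : ∀ a ∈ TA, a.1 = 0 ∧ |a.2.1| ≤ 6 ∧ |a.2.2| ≤ 6 := fun a ha => by
    obtain ⟨h1, h2, h3⟩ := mem_verts ha
    have : ((pc σ).length : ℤ) ≤ 6 := by exact_mod_cast hσ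
    exact ⟨h1, h2.trans this, h3.trans this⟩
  have smB : ∀ b ∈ TB, b.1 = 0 ∧ |b.2.1| ≤ 6 ∧ |b.2.2| ≤ 6 := fun b hb => by
    obtain ⟨h1, h2, h3⟩ := mem_verts hb
    have : ((pc σ').length : ℤ) ≤ 6 := by exact_mod_cast hσ'
    exact ⟨h1, h2.trans this, h3.trans this⟩
  have hbA : bA.toFinset = TA.image vcodeK := by rw [hA, hTA, image_vcodeK_verts]
  have hbB : bB.toFinset = TB.image vcodeK := by rw [hB, hTB, image_vcodeK_verts]
  have hbit : ∀ e ∈ TA, ((Nat.land (maskOf (bA.map (· + 312))) (Nat.shiftLeft (maskOf bB) s)).testBit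
      (vcodeK e + 312) = true ↔ e ∈ TB.map sh) := by
    intro e he
    obtain ⟨het, he1, he2⟩ := smA e he
    rw [abs_le] at he1 he2
    rw [show Nat.land (maskOf (bA.map (· + 312))) (Nat.shiftLeft (maskOf bB) s) =
      (maskOf (bA.map (· + 312))) &&& ((maskOf bB) <<< s) from rfl, Nat.testBit_and, Nat.testBit_shiftLeft,
      testBit_maskOf, testBit_maskOf]
    have hmemA : vcodeK e + 312 ∈ bA.map (· + 312) := by
      rw [List.mem_map]
      exact ⟨vcodeK e, by rw [← List.mem_toFinset, hbA, Finset.mem_image]; exact ⟨e, he, rfl⟩, rfl⟩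
    have hcode : ((vcodeK e : ℕ) : ℤ) = vcodeK (shiftV2 k (-(tr2 y)) e) + voff (tr2 y) := by
      have := vcodeK_shift (k := k) (tr2 y) (q := shiftV2 k (-(tr2 y)) e)
        (by simp [shiftV2]; omega) (by simp [shiftV2]; omega) (by simp [shiftV2]; omega) (by simp [shiftV2]; omega)
      have e2 : shiftV2 k (tr2 y) (shiftV2 k (-(tr2 y)) e) = e := by
        simp [shiftV2]
      rw [e2] at this
      exact this
    have hge : s ≤ vcodeK e + 312 := by
      have h0 : (0 : ℤ) ≤ (vcodeK (shiftV2 k (-(tr2 y)) e) : ℕ) := Nat.cast_nonneg _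
      omega
    have hsub : vcodeK e + 312 - s = vcodeK (shiftV2 k (-(tr2 y)) e) := by omega
    simp only [hmemA, decide_true, Bool.true_and, ge_iff_le, hge, hsub, decide_eq_true_eq]
    rw [← List.mem_toFinset, hbB, Finset.mem_image, Finset.mem_map]
    constructor
    · rintro ⟨b, hb, hbe⟩
      obtain ⟨hbt, hb1, hb2⟩ := smB b hb
      have heq := vcodeK_inj hbt (by simpa [shiftV2] using het) (hb1.trans (by norm_num)) (hb2.trans (by norm_num))
        (by simp only [shiftV2, Function.Embedding.coeFn_mk, Prod.fst_add, Prod.fst_neg, abs_le]; omega)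
        (by simp only [shiftV2, Function.Embedding.coeFn_mk, Prod.snd_add, Prod.snd_neg, abs_le]; omega) hbe
      refine ⟨b, hb, ?_⟩
      rw [heq]; simp [hsh, shiftV2]
    · rintro ⟨b, hb, rfl⟩
      refine ⟨b, hb, ?_⟩
      congr 1
      simp [hsh, shiftV2]
  unfold SV2
  rw [← hTA, ← hTB, ← hsh, Smask_eq]
  have step1 : TA ∩ TB.map sh = TA.filter (fun e => e ∈ TB.map sh) := by
    ext e; simp [Finset.mem_inter, Finset.mem_filter]
  rw [step1]
  have hinjA : Set.InjOn vcodeK (TA : Set (VKey2 k)) := fun a ha a' ha' h =>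
    vcodeK_inj (smA a ha).1 (smA a' ha').1 ((smA a ha).2.1.trans (by norm_num)) ((smA a ha).2.2.trans (by norm_num))
      ((smA a' ha').2.1.trans (by norm_num)) ((smA a' ha').2.2.trans (by norm_num)) h
  set p : ℕ → Bool := fun i => (Nat.land (maskOf (bA.map (· + 312))) (Nat.shiftLeft (maskOf bB) s)).testBit i with hp
  rw [Finset.filter_congr (fun e he => (hbit e he).symm)]
  rw [← Finset.card_image_of_injOn (hinjA.mono (Finset.coe_subset.2 (Finset.filter_subset _ _)))]
  have step3 : (TA.filter fun e => p (vcodeK e + 312) = true).image vcodeK =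
      (TA.image vcodeK).filter fun c => p (c + 312) = true := by
    ext c
    simp only [Finset.mem_image, Finset.mem_filter]
    constructor
    · rintro ⟨b, ⟨hb, hq⟩, rfl⟩; exact ⟨⟨b, hb, rfl⟩, hq⟩
    · rintro ⟨⟨b, hb, rfl⟩, hq⟩; exact ⟨b, ⟨hb, hq⟩, rfl⟩
  rw [step3, ← hbA, ← List.toFinset_filter, List.toFinset_card_of_nodup (hAn.filter _), List.filter_map,
    List.length_map]
  rfl

/-! ### The site functional -/

/-- One pair term of the bit-mask site functional (records `(W, endpoint, bit list)` / `(W, endpoint, shifted mask)`). -/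
def termMS (k A B E : ℕ) (V0t V1t : ℤ × ℤ → ℕ) (y : ℤ × ℤ) (MP : ℕ) (bP : List ℕ)
    (P : ℕ × (ℤ × ℤ) × List ℕ) (Q : ℕ × (ℤ × ℤ) × ℕ) : ℕ :=
  let s := Smask MP bP Q.2.2
  bif Nat.beq s 0 then 0 else
    let uo := y + (Q.2.1 - P.2.1)
    P.1 * Q.1 * ((A ^ s * B ^ (E - s) - B ^ E) * (V0t uo + (k - 1) * V1t uo))

/-- **The bit-mask site certificate functional.** -/
def certFastMS (RS : List (ℕ × (ℤ × ℤ) × List ℕ)) (k A B E : ℕ) (V0t V1t : ℤ × ℤ → ℕ) (y : ℤ × ℤ) (sh : ℕ) : ℕ :=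
  let RQ := RS.map fun Q => (Q.1, Q.2.1, Nat.shiftLeft (maskOf Q.2.2) sh)
  (RS.map fun P =>
    let bP := P.2.2.map (· + 312)
    let MP := maskOf bP
    (RQ.map fun Q => termMS k A B E V0t V1t y MP bP P Q).sum).sum

/-- The pair term without the early exit. -/
theorem termMS_eq (k A B E : ℕ) (V0t V1t : ℤ × ℤ → ℕ) (y : ℤ × ℤ) (MP : ℕ) (bP : List ℕ)
    (P : ℕ × (ℤ × ℤ) × List ℕ) (Q : ℕ × (ℤ × ℤ) × ℕ) :
    termMS k A B E V0t V1t y MP bP P Q =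
      P.1 * Q.1 * ((A ^ Smask MP bP Q.2.2 * B ^ (E - Smask MP bP Q.2.2) - B ^ E) *
        (V0t (y + (Q.2.1 - P.2.1)) + (k - 1) * V1t (y + (Q.2.1 - P.2.1)))) := by
  unfold termMS
  simp only
  cases hs : Nat.beq (Smask MP bP Q.2.2) 0
  · rfl
  · have h0 : Smask MP bP Q.2.2 = 0 := Nat.eq_of_beq_eq_true hs
    rw [h0]
    simp

/-- **The bridge**: `BSMX.certLHSVz` (true shared-vertex count `BSMX.SV`, pair-indexed tables) equals the cast of
`BSMR.certFastMS`, for pieces of length `≤ 6`, offsets `|y| ≤ 6`, and `B ≤ A`. -/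
theorem certLHSVz_eq_certFastMS (pc : Fin np → List (Fin 2 × Bool)) (RS : List (ℕ × (ℤ × ℤ) × List ℕ))
    (hlen : RS.length = np) (W : Fin np → ℕ)
    (hRS : ∀ σ : Fin np, RS.getD σ (0, (0, 0), []) = (W σ, tr2 (pend (pc σ)), tvbits (0, 0) (pc σ)))
    (hnd : ∀ σ, (tvbits (0, 0) (pc σ)).Nodup) (hL : ∀ σ, (pc σ).length ≤ 6)
    (k A B E : ℕ) (hBA : B ≤ A) (hE : ∀ σ, (pc σ).length + 1 ≤ E) (V0t V1t : ℤ × ℤ → ℕ) {y : Fin 2 → ℤ}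
    (hy0 : |y 0| ≤ 6) (hy1 : |y 1| ≤ 6) :
    certLHSVz (fun σ => pend (pc σ)) (SV pc k) W k A B E (fun u => V0t (tr2 u)) (fun u => V1t (tr2 u)) y =
      ((certFastMS RS k A B E V0t V1t (tr2 y) (shOfV (tr2 y)) : ℕ) : ℤ) := by
  subst hlen
  have hget : ∀ σ : Fin RS.length, RS[(σ : ℕ)] = (W σ, tr2 (pend (pc σ)), tvbits (0, 0) (pc σ)) := fun σ => by
    rw [← hRS σ, List.getD_eq_getElem _ _ σ.2]
  have hsum : ∀ (f : Fin RS.length → ℤ) (F : ℕ × (ℤ × ℤ) × List ℕ → ℤ),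
      (∀ i : Fin RS.length, f i = F RS[(i : ℕ)]) → ∑ i, f i = (RS.map F).sum := by
    intro f F h
    have : List.ofFn f = RS.map F := by
      apply List.ext_getElem (by simp)
      intro i h1 h2
      rw [List.getElem_ofFn, List.getElem_map, h ⟨i, by simpa using h1⟩]
    rw [← List.sum_ofFn, this]
  unfold certLHSVz certFastMS
  dsimp only
  rw [Nat.cast_list_sum, List.map_map]
  refine hsum _ _ fun σ => ?_
  rw [Function.comp_apply, Nat.cast_list_sum, List.map_map, List.map_map]
  refine hsum _ _ fun σ' => ?_
  rw [Function.comp_apply, Function.comp_apply, hget σ, hget σ', termMS_eq]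
  dsimp only
  have hS : Smask (maskOf ((tvbits (0, 0) (pc σ)).map (· + 312))) ((tvbits (0, 0) (pc σ)).map (· + 312))
      (Nat.shiftLeft (maskOf (tvbits (0, 0) (pc σ'))) (shOfV (tr2 y))) = SV pc k y σ σ' := by
    rw [SV_eq_SV2, SV2_eq_Smask pc k y σ σ' rfl rfl (hnd σ) (hL σ) (hL σ') hy0 hy1]
  rw [hS]
  have hs : SV pc k y σ σ' ≤ E := (SV_le_length pc k y σ σ').trans (hE σ)
  have h2 : B ^ E ≤ A ^ SV pc k y σ σ' * B ^ (E - SV pc k y σ σ') := by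
    calc B ^ E = B ^ SV pc k y σ σ' * B ^ (E - SV pc k y σ σ') := by rw [← pow_add, Nat.add_sub_cancel' hs]
      _ ≤ A ^ SV pc k y σ σ' * B ^ (E - SV pc k y σ σ') := Nat.mul_le_mul_right _ (Nat.pow_le_pow_left hBA _)
  have huo : tr2 y + (tr2 (pend (pc σ')) - tr2 (pend (pc σ))) = tr2 (y + (pend (pc σ') - pend (pc σ))) := by
    rw [tr2_add, tr2_sub]
  rw [huo]
  push_cast [Nat.cast_sub h2]
  ring

end Summit.CriticalPhenomena.PercolationContinuityZ3.Theorems.Pcint.BSMR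

end
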